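import Mathlib.Geometry.Manifold.Instances.Sphere
import Mathlib.Geometry.Manifold.MFDeriv.SpecificFunctions
import Mathlib.Geometry.Manifold.ContMDiff.NormedSpace
import Literature.Topology.FourManifolds.MMSWRasmussenGeneralPosition
import Summits.SmoothPoincare4.SmoothPoincare4.Theses.DottedCircleRasmussen

/-!
# Helper `helper_friendsCarrier_Vk_flowTube` (piece 11 of the registered helper `helper_friendsCarrier_Vk`,
stub `stub_friendsCarrier`, line `mk_friends`, skeleton v5) for crux `DcrGap`
(item stmt-SmoothPoincare4-16128, route route-SmoothPoincare4-DottedCircleRasmussen)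

**The flow-out of the knot tube is a tube.**  In the `k = 0` template the tube of the straightened
slice disc over the boundary band is the cone `‖x‖ • ν(x/‖x‖, w)` over the tube `ν` of the knot in `S³`
(`TubularNbhdConeTube.lean`: a `C^∞` injective immersion).  Its `k ≥ 1` replacement is the flow-out
`FT(s, q) = Φ(s, νK q)` of the tube `νK : S¹ × ℝ² → M_k` of `K₁` (the datum of the registered helper
`helper_friendsCarrier_Vk`: a `C^∞` injective immersion into `M_k`) under the clocked collar flow `Φ`
of `helper_friendsCarrier_Vk_clockFlow`.  This file proves: `FT` is `C^∞` on `ℝ × (S¹ × ℝ²)`; it lies at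
level `G_k = 1 + s` (`|s| ≤ 2ε`); it is injective on `|s| ≤ 2ε` (the level separates times, `Φ_s` is
injective); and it is an immersion for `|s| < 2ε`: if `dFT(σ, v) = 0` then `σ = dG_k(dFT(σ, v)) = 0`
(the level identity differentiated on the manifold `ℝ × S¹ × ℝ²`), and then
`dΦ_s(dνK v) = 0` forces `v = 0` (`Φ_s` is a diffeomorphism with inverse `Φ_{-s}`, `νK` an immersion).

No definitions, no named facts, no `sorry`.
-/

-- the prescribed namespace `Summit.<P>.<Sub>.…` duplicates `SmoothPoincare4` (P = Sub)
set_option linter.dupNamespace false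
set_option linter.style.longLine false

noncomputable section

open scoped Manifold ContDiff Topology
open Set Function Metric Filter
open Literature.Topology.FourManifolds Literature.Topology.FourManifolds.MMSW

namespace Summit.SmoothPoincare4.SmoothPoincare4.Theorems.DcrGap.MkFriends

namespace FriendsCarrierVk

/-- The time-`s` map of a flow with the group law has injective differential (its inverse is the
time-`-s` map). [folklore]

Deprecated duplicate (dedup-03054): this is the `E = ℝ⁴` instance of
`Literature.Topology.FourManifolds.MMSW.flow_fderiv_injective` (`MMSWRasmussenGeneralPosition.lean`),
which is imported and opened here; use that lemma. -/
@[deprecated Literature.Topology.FourManifolds.MMSW.flow_fderiv_injective (since := "2026-08-17")]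
theorem injective_fderiv_flow {Φ : ℝ × EuclideanSpace ℝ (Fin 4) → EuclideanSpace ℝ (Fin 4)} (hΦs : ContDiff ℝ ∞ Φ)
    (h0 : ∀ x, Φ (0, x) = x) (hadd : ∀ s t x, Φ (s, Φ (t, x)) = Φ (s + t, x)) (s : ℝ) (y : EuclideanSpace ℝ (Fin 4)) :
    Injective (fderiv ℝ (fun y => Φ (s, y)) y) :=
  flow_fderiv_injective hΦs h0 hadd s y

set_option maxHeartbeats 800000 in
/-- **The flow-out of the knot tube is a `C^∞` injective immersion at level `1 + s`.** [folklore] -/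
theorem flowTube {k : ℕ} {νK : (sphere (0 : EuclideanSpace ℝ (Fin 2)) 1) × EuclideanSpace ℝ (Fin 2) → EuclideanSpace ℝ (Fin 4)}
    {Φ : ℝ × EuclideanSpace ℝ (Fin 4) → EuclideanSpace ℝ (Fin 4)} {ε : ℝ}
    (hν : ContMDiff ((𝓡 1).prod 𝓘(ℝ, EuclideanSpace ℝ (Fin 2))) 𝓘(ℝ, EuclideanSpace ℝ (Fin 4)) ∞ νK)
    (hνi : Injective νK)
    (hνd : ∀ p, Injective (mfderiv ((𝓡 1).prod 𝓘(ℝ, EuclideanSpace ℝ (Fin 2))) 𝓘(ℝ, EuclideanSpace ℝ (Fin 4)) νK p))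
    (hνM : ∀ p, νK p ∈ modelBoundary k)
    (hΦs : ContDiff ℝ ∞ Φ) (h0 : ∀ x, Φ (0, x) = x) (hadd : ∀ s t x, Φ (s, Φ (t, x)) = Φ (s + t, x))
    (hclock : ∀ x ∈ modelBoundary k, ∀ s : ℝ, |s| ≤ 2 * ε →
      (∀ j, (1 : ℝ) / 2 < holeTerm k j (Φ (s, x))) ∧ levelFun k (Φ (s, x)) = 1 + s) :
    ContMDiff (𝓘(ℝ, ℝ).prod ((𝓡 1).prod 𝓘(ℝ, EuclideanSpace ℝ (Fin 2)))) 𝓘(ℝ, EuclideanSpace ℝ (Fin 4)) ∞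
      (fun p : ℝ × ((sphere (0 : EuclideanSpace ℝ (Fin 2)) 1) × EuclideanSpace ℝ (Fin 2)) => Φ (p.1, νK p.2)) ∧
    (∀ p : ℝ × ((sphere (0 : EuclideanSpace ℝ (Fin 2)) 1) × EuclideanSpace ℝ (Fin 2)), |p.1| ≤ 2 * ε →
      levelFun k (Φ (p.1, νK p.2)) = 1 + p.1) ∧
    (∀ p p' : ℝ × ((sphere (0 : EuclideanSpace ℝ (Fin 2)) 1) × EuclideanSpace ℝ (Fin 2)), |p.1| ≤ 2 * ε → |p'.1| ≤ 2 * ε →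
      Φ (p.1, νK p.2) = Φ (p'.1, νK p'.2) → p = p') ∧
    (∀ p : ℝ × ((sphere (0 : EuclideanSpace ℝ (Fin 2)) 1) × EuclideanSpace ℝ (Fin 2)), |p.1| < 2 * ε →
      Injective (mfderiv (𝓘(ℝ, ℝ).prod ((𝓡 1).prod 𝓘(ℝ, EuclideanSpace ℝ (Fin 2)))) 𝓘(ℝ, EuclideanSpace ℝ (Fin 4))
        (fun p : ℝ × ((sphere (0 : EuclideanSpace ℝ (Fin 2)) 1) × EuclideanSpace ℝ (Fin 2)) => Φ (p.1, νK p.2)) p)) := by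
  -- smoothness
  have hΦm : ContMDiff 𝓘(ℝ, ℝ × EuclideanSpace ℝ (Fin 4)) 𝓘(ℝ, EuclideanSpace ℝ (Fin 4)) ∞ Φ := hΦs.contMDiff
  have hinner : ContMDiff (𝓘(ℝ, ℝ).prod ((𝓡 1).prod 𝓘(ℝ, EuclideanSpace ℝ (Fin 2)))) 𝓘(ℝ, ℝ × EuclideanSpace ℝ (Fin 4)) ∞
      (fun p : ℝ × ((sphere (0 : EuclideanSpace ℝ (Fin 2)) 1) × EuclideanSpace ℝ (Fin 2)) => (p.1, νK p.2)) :=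
    contMDiff_fst.prodMk_space (hν.comp contMDiff_snd)
  have hFT : ContMDiff (𝓘(ℝ, ℝ).prod ((𝓡 1).prod 𝓘(ℝ, EuclideanSpace ℝ (Fin 2)))) 𝓘(ℝ, EuclideanSpace ℝ (Fin 4)) ∞
      (fun p : ℝ × ((sphere (0 : EuclideanSpace ℝ (Fin 2)) 1) × EuclideanSpace ℝ (Fin 2)) => Φ (p.1, νK p.2)) :=
    hΦm.comp hinner
  -- level
  have hlev : ∀ p : ℝ × ((sphere (0 : EuclideanSpace ℝ (Fin 2)) 1) × EuclideanSpace ℝ (Fin 2)), |p.1| ≤ 2 * ε →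
      levelFun k (Φ (p.1, νK p.2)) = 1 + p.1 := fun p hp => (hclock _ (hνM p.2) p.1 hp).2
  -- injectivity
  have hinj : ∀ p p' : ℝ × ((sphere (0 : EuclideanSpace ℝ (Fin 2)) 1) × EuclideanSpace ℝ (Fin 2)), |p.1| ≤ 2 * ε → |p'.1| ≤ 2 * ε →
      Φ (p.1, νK p.2) = Φ (p'.1, νK p'.2) → p = p' := by
    rintro ⟨s, q⟩ ⟨s', q'⟩ hs hs' heq
    simp only at hs hs' heq
    have hss : s = s' := by
      have h1 := hlev (s, q) hs
      have h2 := hlev (s', q') hs'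
      simp only at h1 h2
      rw [heq] at h1
      linarith
    subst hss
    have h1 : νK q = νK q' := by
      have := congrArg (fun y => Φ (-s, y)) heq
      simpa [hadd, h0] using this
    exact Prod.ext rfl (hνi h1)
  refine ⟨hFT, hlev, hinj, fun p hp => ?_⟩
  -- immersion
  obtain ⟨s, q⟩ := p
  simp only at hp
  set FT : ℝ × ((sphere (0 : EuclideanSpace ℝ (Fin 2)) 1) × EuclideanSpace ℝ (Fin 2)) → EuclideanSpace ℝ (Fin 4) :=
    fun p => Φ (p.1, νK p.2) with hFTdef
  set L := mfderiv (𝓘(ℝ, ℝ).prod ((𝓡 1).prod 𝓘(ℝ, EuclideanSpace ℝ (Fin 2)))) 𝓘(ℝ, EuclideanSpace ℝ (Fin 4)) FT (s, q) with hL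
  have hFTd : HasMFDerivAt (𝓘(ℝ, ℝ).prod ((𝓡 1).prod 𝓘(ℝ, EuclideanSpace ℝ (Fin 2)))) 𝓘(ℝ, EuclideanSpace ℝ (Fin 4)) FT (s, q) L :=
    (hFT.mdifferentiableAt (by simp)).hasMFDerivAt
  -- Step 1: the clock differentiated: `dG(L X) = X.1`
  have hG : HasMFDerivAt 𝓘(ℝ, EuclideanSpace ℝ (Fin 4)) 𝓘(ℝ, ℝ) (levelFun k) (FT (s, q)) (fderiv ℝ (levelFun k) (FT (s, q))) := by
    rw [hasMFDerivAt_iff_hasFDerivAt]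
    have hne : ∀ j, holeTerm k j (FT (s, q)) ≠ 0 := fun j =>
      (lt_trans (by norm_num) ((hclock _ (hνM q) s hp.le).1 j)).ne'
    exact ((contDiffAt_levelFun hne).differentiableAt (by simp)).hasFDerivAt
  have hcomp1 := hG.comp (s, q) hFTd
  have hlin : HasMFDerivAt (𝓘(ℝ, ℝ).prod ((𝓡 1).prod 𝓘(ℝ, EuclideanSpace ℝ (Fin 2)))) 𝓘(ℝ, ℝ)
      (fun p : ℝ × ((sphere (0 : EuclideanSpace ℝ (Fin 2)) 1) × EuclideanSpace ℝ (Fin 2)) => (1 : ℝ) + p.1) (s, q)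
      ((ContinuousLinearMap.id ℝ ℝ).comp (ContinuousLinearMap.fst ℝ (TangentSpace 𝓘(ℝ, ℝ) s)
        (TangentSpace ((𝓡 1).prod 𝓘(ℝ, EuclideanSpace ℝ (Fin 2))) q))) := by
    have h1 : HasMFDerivAt 𝓘(ℝ, ℝ) 𝓘(ℝ, ℝ) (fun t : ℝ => (1 : ℝ) + t) s (ContinuousLinearMap.id ℝ ℝ) := by
      rw [hasMFDerivAt_iff_hasFDerivAt]
      exact (hasFDerivAt_id s).const_add (1 : ℝ)
    exact h1.comp (s, q) (hasMFDerivAt_fst (I := 𝓘(ℝ, ℝ)) (I' := (𝓡 1).prod 𝓘(ℝ, EuclideanSpace ℝ (Fin 2))) (s, q))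
  have hev : (fun p : ℝ × ((sphere (0 : EuclideanSpace ℝ (Fin 2)) 1) × EuclideanSpace ℝ (Fin 2)) => (1 : ℝ) + p.1) =ᶠ[𝓝 (s, q)]
      (levelFun k ∘ FT) := by
    have hopen : IsOpen {p : ℝ × ((sphere (0 : EuclideanSpace ℝ (Fin 2)) 1) × EuclideanSpace ℝ (Fin 2)) | |p.1| < 2 * ε} :=
      isOpen_lt (continuous_abs.comp continuous_fst) continuous_const
    filter_upwards [hopen.mem_nhds (show |((s, q) : ℝ × _).1| < 2 * ε from hp)] with p hp'
    exact (hlev p hp'.le).symm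
  have hlin' := hlin.congr_of_eventuallyEq hev.symm
  have hderivG : (fderiv ℝ (levelFun k) (FT (s, q))).comp L =
      (ContinuousLinearMap.id ℝ ℝ).comp (ContinuousLinearMap.fst ℝ (TangentSpace 𝓘(ℝ, ℝ) s)
        (TangentSpace ((𝓡 1).prod 𝓘(ℝ, EuclideanSpace ℝ (Fin 2))) q)) :=
    hcomp1.mfderiv.symm.trans hlin'.mfderiv
  -- Step 2: the slice at time `s`: `L (0, v) = dΦ_s (dνK v)`
  have hslice : HasMFDerivAt ((𝓡 1).prod 𝓘(ℝ, EuclideanSpace ℝ (Fin 2))) (𝓘(ℝ, ℝ).prod ((𝓡 1).prod 𝓘(ℝ, EuclideanSpace ℝ (Fin 2))))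
      (fun q' : (sphere (0 : EuclideanSpace ℝ (Fin 2)) 1) × EuclideanSpace ℝ (Fin 2) => ((s, q') : ℝ × _)) q
      ((0 : TangentSpace ((𝓡 1).prod 𝓘(ℝ, EuclideanSpace ℝ (Fin 2))) q →L[ℝ] TangentSpace 𝓘(ℝ, ℝ) s).prod
        (ContinuousLinearMap.id ℝ (TangentSpace ((𝓡 1).prod 𝓘(ℝ, EuclideanSpace ℝ (Fin 2))) q))) :=
    (hasMFDerivAt_const (I := (𝓡 1).prod 𝓘(ℝ, EuclideanSpace ℝ (Fin 2))) (I' := 𝓘(ℝ, ℝ)) s q).prodMk (hasMFDerivAt_id q)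
  have hcomp2 := hFTd.comp q hslice
  have hΦsd : HasMFDerivAt 𝓘(ℝ, EuclideanSpace ℝ (Fin 4)) 𝓘(ℝ, EuclideanSpace ℝ (Fin 4)) (fun y => Φ (s, y)) (νK q)
      (fderiv ℝ (fun y => Φ (s, y)) (νK q)) := by
    rw [hasMFDerivAt_iff_hasFDerivAt]
    exact ((hΦs.differentiable (by simp)).comp (differentiable_const _ |>.prodMk differentiable_id) _).hasFDerivAt
  have hνq : HasMFDerivAt ((𝓡 1).prod 𝓘(ℝ, EuclideanSpace ℝ (Fin 2))) 𝓘(ℝ, EuclideanSpace ℝ (Fin 4)) νK q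
      (mfderiv ((𝓡 1).prod 𝓘(ℝ, EuclideanSpace ℝ (Fin 2))) 𝓘(ℝ, EuclideanSpace ℝ (Fin 4)) νK q) :=
    (hν.mdifferentiableAt (by simp)).hasMFDerivAt
  have hcomp3 := hΦsd.comp q hνq
  have hsame : (FT ∘ fun q' : (sphere (0 : EuclideanSpace ℝ (Fin 2)) 1) × EuclideanSpace ℝ (Fin 2) => ((s, q') : ℝ × _)) =
      ((fun y => Φ (s, y)) ∘ νK) := by
    funext q'; rfl
  rw [hsame] at hcomp2
  have hderiv2 := hcomp2.mfderiv.symm.trans hcomp3.mfderiv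
  -- conclusion, in the model product `ℝ × (ℝ¹ × ℝ²)` of the tangent space
  have key : ∀ Z : ℝ × (EuclideanSpace ℝ (Fin 1) × EuclideanSpace ℝ (Fin 2)), L Z = 0 → Z = 0 := by
    rintro ⟨σ, v⟩ hZ
    -- `σ = 0` from the clock
    have e1 : ((fderiv ℝ (levelFun k) (FT (s, q))).comp L) (σ, v) = 0 :=
      (congrArg (fderiv ℝ (levelFun k) (FT (s, q))) hZ).trans (map_zero _)
    rw [hderivG] at e1
    have h1 : σ = 0 := e1
    subst h1
    -- `v = 0` from the slice
    have e3 : (L.comp (((0 : TangentSpace ((𝓡 1).prod 𝓘(ℝ, EuclideanSpace ℝ (Fin 2))) q →L[ℝ] TangentSpace 𝓘(ℝ, ℝ) s).prod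
        (ContinuousLinearMap.id ℝ (TangentSpace ((𝓡 1).prod 𝓘(ℝ, EuclideanSpace ℝ (Fin 2))) q))))) v = 0 :=
      (rfl : (L.comp (((0 : TangentSpace ((𝓡 1).prod 𝓘(ℝ, EuclideanSpace ℝ (Fin 2))) q →L[ℝ] TangentSpace 𝓘(ℝ, ℝ) s).prod
        (ContinuousLinearMap.id ℝ (TangentSpace ((𝓡 1).prod 𝓘(ℝ, EuclideanSpace ℝ (Fin 2))) q))))) v =
        L (((0 : ℝ), v) : ℝ × (EuclideanSpace ℝ (Fin 1) × EuclideanSpace ℝ (Fin 2)))).trans hZ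
    rw [hderiv2] at e3
    have e5 : fderiv ℝ (fun y => Φ (s, y)) (νK q)
        (mfderiv ((𝓡 1).prod 𝓘(ℝ, EuclideanSpace ℝ (Fin 2))) 𝓘(ℝ, EuclideanSpace ℝ (Fin 4)) νK q v) = 0 := e3
    have h3 : mfderiv ((𝓡 1).prod 𝓘(ℝ, EuclideanSpace ℝ (Fin 2))) 𝓘(ℝ, EuclideanSpace ℝ (Fin 4)) νK q v = 0 :=
      (injective_iff_map_eq_zero _).1 (flow_fderiv_injective hΦs h0 hadd s (νK q)) _ e5
    have h4 : v = 0 := (injective_iff_map_eq_zero _).1 (hνd q) _ h3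
    subst h4
    rfl
  intro X X' hXX'
  rw [← sub_eq_zero] at hXX' ⊢
  rw [← map_sub] at hXX'
  exact key (X - X') hXX'

end FriendsCarrierVk

open FriendsCarrierVk in
/-- **Helper `helper_friendsCarrier_Vk_flowTube`** (registered piece of `helper_friendsCarrier_Vk`: the flow-out
of the knot tube is a tube).  For a `C^∞` injective immersion `νK : S¹ × ℝ² → M_k` and a `C^∞` flow `Φ`
with the group law and the clock on `M_k` (`helper_friendsCarrier_Vk_clockFlow`), the flow-out
`(s, q) ↦ Φ(s, νK q)` is `C^∞` on `ℝ × (S¹ × ℝ²)`, lies at level `G_k = 1 + s` for `|s| ≤ 2ε`, is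
injective there, and is an immersion for `|s| < 2ε`. [folklore] -/
theorem helper_friendsCarrier_Vk_flowTube : ∀ (k : ℕ) (νK : (Metric.sphere (0 : EuclideanSpace ℝ (Fin 2)) 1) × EuclideanSpace ℝ (Fin 2) → EuclideanSpace ℝ (Fin 4)) (Φ : ℝ × EuclideanSpace ℝ (Fin 4) → EuclideanSpace ℝ (Fin 4)) (ε : ℝ), ContMDiff ((𝓡 1).prod 𝓘(ℝ, EuclideanSpace ℝ (Fin 2))) 𝓘(ℝ, EuclideanSpace ℝ (Fin 4)) ((⊤ : ℕ∞) : WithTop ℕ∞) νK → Function.Injective νK → (∀ p, Function.Injective (mfderiv ((𝓡 1).prod 𝓘(ℝ, EuclideanSpace ℝ (Fin 2))) 𝓘(ℝ, EuclideanSpace ℝ (Fin 4)) νK p)) → (∀ p, νK p ∈ Literature.Topology.FourManifolds.MMSW.modelBoundary k) → ContDiff ℝ ((⊤ : ℕ∞) : WithTop ℕ∞) Φ → (∀ x, Φ (0, x) = x) → (∀ s t x, Φ (s, Φ (t, x)) = Φ (s + t, x)) → (∀ x ∈ Literature.Topology.FourManifolds.MMSW.modelBoundary k, ∀ s : ℝ,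 |s| ≤ 2 * ε → (∀ j, (1 : ℝ) / 2 < Literature.Topology.FourManifolds.MMSW.holeTerm k j (Φ (s, x))) ∧ Literature.Topology.FourManifolds.MMSW.levelFun k (Φ (s, x)) = 1 + s) → ContMDiff (𝓘(ℝ, ℝ).prod ((𝓡 1).prod 𝓘(ℝ, EuclideanSpace ℝ (Fin 2)))) 𝓘(ℝ, EuclideanSpace ℝ (Fin 4)) ((⊤ : ℕ∞) : WithTop ℕ∞) (fun p : ℝ × ((Metric.sphere (0 : EuclideanSpace ℝ (Fin 2)) 1) × EuclideanSpace ℝ (Fin 2)) => Φ (p.1, νK p.2)) ∧ (∀ p : ℝ × ((Metric.sphere (0 : EuclideanSpace ℝ (Fin 2)) 1) × EuclideanSpace ℝ (Fin 2)), |p.1| ≤ 2 * ε → Literature.Topology.FourManifolds.MMSW.levelFun k (Φ (p.1, νK p.2)) = 1 + p.1) ∧ (∀ p p' : ℝ × ((Metric.sphere (0 : EuclideanSpace ℝ (Fin 2)) 1) × EuclideanSpace ℝ (Fin 2)), |p.1| ≤ 2 * ε → |p'.1| ≤ 2 * ε → Φ (p.1, νK p.2) = Φ (p'.1, νK p'.2)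 → p = p') ∧ (∀ p : ℝ × ((Metric.sphere (0 : EuclideanSpace ℝ (Fin 2)) 1) × EuclideanSpace ℝ (Fin 2)), |p.1| < 2 * ε → Function.Injective (mfderiv (𝓘(ℝ, ℝ).prod ((𝓡 1).prod 𝓘(ℝ, EuclideanSpace ℝ (Fin 2)))) 𝓘(ℝ, EuclideanSpace ℝ (Fin 4)) (fun p : ℝ × ((Metric.sphere (0 : EuclideanSpace ℝ (Fin 2)) 1) × EuclideanSpace ℝ (Fin 2)) => Φ (p.1, νK p.2)) p)) :=
  fun _ _ _ _ hν hνi hνd hνM hΦs h0 hadd hclock => flowTube hν hνi hνd hνM hΦs h0 hadd hclock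

end Summit.SmoothPoincare4.SmoothPoincare4.Theorems.DcrGap.MkFriends

end
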